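import Literature.NumberTheory.LFunctions.MultiplicativeCorrelations
import Literature.NumberTheory.LFunctions.TaoLogChowla
import Literature.NumberTheory.LFunctions.TaoLogElliottReduction
import Literature.NumberTheory.LFunctions.LiouvilleNonpretentious
import Literature.NumberTheory.LFunctions.TaoLogChowlaMoebius
import HarnessLib

/-!
# Correlations of multiplicative functions: proofs for `MultiplicativeCorrelations`

Proof layer for the named facts of `Literature.NumberTheory.LFunctions.MultiplicativeCorrelations`
(Tao, Forum Math. Pi 4 (2016) e8; arXiv:1509.05422 — page and statement numbers below refer to
the arXiv version, equation numbers are avoided since they differ between the versions).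

Tao deduces Theorem 1.2 (`Literature.NumberTheory.Sieve.tao_log_chowla_liouville`, and its two-point case
`Literature.NumberTheory.LFunctions.tao_log_chowla_two`) from Theorem 1.3 (`Literature.NumberTheory.LFunctions.tao_log_averaged_elliott_two`) in two printed
steps (pp. 4–5): "Theorem 1.3 clearly implies the following asymptotic version: Corollary 1.5"
and "it is not difficult to establish [the non-pretentiousness hypothesis] when `g` is the
Liouville function ... Thus Corollary 1.5 implies Theorem 1.2."  The sibling files
`TaoLogChowla` / `LiouvilleNonpretentious` carry out the second step for `g₁ = g₂ = λ`, `ω = x`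
(`Literature.NumberTheory.LFunctions.tao_log_chowla_liouville_of_elliott_two`, with the non-pretentiousness of `λ` proved
unconditionally: `Literature.NumberTheory.LFunctions.Tao2016_liouvilleNonpretentious_holds`, `Literature.NumberTheory.LFunctions.isNonpretentious_liouville_holds`).
This file adds:

* `Literature.NumberTheory.LFunctions.tao_log_chowla_two_of_liouville`, `Literature.NumberTheory.LFunctions.tao_log_chowla_two_of_elliott_two`,
  `Literature.NumberTheory.LFunctions.tao_log_chowla_two_of_theorem23`: the two-point fact `Literature.NumberTheory.LFunctions.tao_log_chowla_two`
  (`∑_{n ≤ x} λ(n) λ(n+h) / n = o(log x)`, `h ≠ 0`) is the case `a₁ = a₂ = 1`, `b₁ = 0`, `b₂ = h`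
  of parity.S21, hence follows from the single named fact `Literature.NumberTheory.LFunctions.tao_log_averaged_elliott_two`
  (Tao 2016, Thm 1.3), and likewise from `Literature.NumberTheory.LFunctions.Tao2016_theorem23` (Tao 2016, Thm 2.3) alone.
* `Literature.NumberTheory.LFunctions.log_averaged_elliott_of_nonasymptotic`: **Corollary 1.5 as printed** (general
  `1`-bounded multiplicative `g₁, g₂`, general cutoff `ω(x) → ∞`, `ω(x) ≤ x`) from Theorem 1.3,
  under the per-character hypothesis `Literature.IsNonpretentious g₁` (`inf_{|t| ≤ x} 𝔻(g₁, χ(n)n^{it}; x)² → ∞`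
  for each fixed `χ`, i.e. the printed hypothesis with `A = 1`); the passage to the hypothesis
  shape of Theorem 1.3 (`|t| ≤ A x`, all `q ≤ A`, fixed `A`) is
  `Literature.NumberTheory.Sieve.IsNonpretentious.eventually_le_pretentiousDistSq`, which costs only the primes in
  `(x, A x]` (`Literature.NumberTheory.LFunctions.pretentiousDistSq_le_add_of_le`, a crude Mertens bound) and uses that there are
  finitely many characters of modulus `≤ A`.
* `Literature.NumberTheory.LFunctions.log_averaged_elliott_nat_of_nonasymptotic`: the case `ω(x) = x` along `x : ℕ` with the
  sum extended to `n = 1` (that term is bounded by `1 = o(log x)`).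
* `Literature.NumberTheory.LFunctions.tao_log_chowla_omega_of_elliott_two`: **Theorem 1.2 as printed** (general cutoff `ω`) for
  `λ`, from Theorem 1.3 alone.

* `Literature.NumberTheory.LFunctions.chowlaConjecture_of_elliottConjectureMRT`,
  `Literature.NumberTheory.LFunctions.moebiusChowlaConjecture_of_elliottConjectureMRT`: the corrected Elliott
  conjecture `Literature.NumberTheory.LFunctions.ElliottConjectureMRT` (Matomäki–Radziwiłł–Tao 2015, Conjecture 1.5
  with hypothesis (1.8)) implies Chowla's conjecture `Literature.NumberTheory.Sieve.ChowlaConjecture` and its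
  Möbius/Sarnak form `Literature.NumberTheory.Sieve.MoebiusChowlaConjecture`, UNCONDITIONALLY in `λ`, `μ` (their
  non-pretentiousness being the theorems `isNonpretentious_liouville_holds`, `isNonpretentious_moebius_holds`).
  This is the printed remark "so Elliott's conjecture implies Chowla's conjecture" (MRT 2015, §1, after
  Conjecture 1.5) and records why the named fact `ElliottConjectureMRT` — an open conjecture — has no
  discharge `ElliottConjectureMRT_holds` in the tree: it contains the open case `k = 2` of Chowla's
  conjecture. (Auxiliary: `Literature.NumberTheory.LFunctions.isLittleO_sum_range_of_sum_Icc`,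
  `Literature.NumberTheory.LFunctions.isLittleO_intCast_real_of_complex` move between the `∑_{1 ≤ n ≤ x}` /
  complex normalisation of parity.S24 and the `∑_{n < x}` / integer normalisation of parity.S06.)

What remains for `tao_log_chowla_two_holds`: a proof of Tao's Theorem 1.3 (equivalently, by
`TaoLogElliottReduction` / `TaoLogElliottSection2`, of Theorem 2.3 = `Literature.NumberTheory.LFunctions.Tao2016_theorem23`,
the entropy-decrement core of the paper, §§3–4, resting on Matomäki–Radziwiłł–Tao 2015 and
Matomäki–Radziwiłł 2016).

## References
* T. Tao, *The logarithmically averaged Chowla and Elliott conjectures for two-point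
  correlations*, Forum Math. Pi 4 (2016), e8; arXiv:1509.05422. Theorem 1.2, Theorem 1.3,
  Corollary 1.5, §1 p. 5, §2 Theorem 2.3.
* K. Matomäki, M. Radziwiłł, T. Tao, *An averaged form of Chowla's conjecture*, Algebra & Number
  Theory 9 (2015), 2167–2196; arXiv:1503.05121. §1, Conjecture 1.5, (1.6)–(1.8) and the sentence
  "so Elliott's conjecture implies Chowla's conjecture" (arXiv p. 4).
* O. Klurman, A. P. Mangerel, J. Teräväinen, *On Elliott's conjecture and applications*,
  arXiv:2304.05344 (2023), §1: the corrected conjecture is open and "believed to be true"; the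
  two-point case holds at almost all scales (Theorem 1.2).

## Design choices
* No new definitions; all statements are the `Prop`s of `MultiplicativeCorrelations`,
  `ParityWave0`, `TaoLogChowla`, `TaoLogElliottReduction`, `PretentiousDistance`, unchanged.
* In Corollary 1.5 the cutoff is any `ω : ℝ → ℝ` with `ω x ≤ x` eventually and `ω → ∞` (the
  printed `1 ≤ ω(x)` is then automatic for large `x`); shifts are natural numbers as in the
  vendored Theorem 1.3.
-/

open Filter Asymptotics Finset

namespace Literature.NumberTheory.LFunctions

section Reductions

open scoped ComplexConjugate

/-! ### Enlarging the `t`-range: Corollary 1.5's hypothesis versus Theorem 1.3's -/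

/-- Truncation bound for the pretentious distance of `1`-bounded functions: for `x ≤ y`,
`𝔻(f, g; y)² ≤ 𝔻(f, g; x)² + 2 (⌊y⌋₊ + 1) / (⌊x⌋₊ + 1)`, since each prime `p ∈ (x, y]`
contributes `(1 - Re f(p) conj g(p)) / p ≤ 2 / (⌊x⌋₊ + 1)` and there are at most `⌊y⌋₊ + 1` of
them. (Crude form of Mertens' `∑_{x < p ≤ y} 1/p = log (log y / log x) + o(1)`; the special case
`f = λ` is `Literature.NumberTheory.LFunctions.pretentiousDistSq_liouville_mono_add`.) [folklore] -/
theorem pretentiousDistSq_le_add_of_le {f g : ℕ → ℂ} (hf : ∀ n, ‖f n‖ ≤ 1)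
    (hg : ∀ n, ‖g n‖ ≤ 1) {x y : ℝ} (hxy : x ≤ y) :
    Sieve.pretentiousDistSq f g y ≤
      Sieve.pretentiousDistSq f g x + 2 * ((⌊y⌋₊ : ℝ) + 1) / ((⌊x⌋₊ : ℝ) + 1) := by
  unfold Sieve.pretentiousDistSq
  have hsub : Nat.primesLE ⌊x⌋₊ ⊆ Nat.primesLE ⌊y⌋₊ := by
    intro p hp
    rw [Nat.mem_primesLE] at hp ⊢
    exact ⟨hp.1.trans (Nat.floor_le_floor hxy), hp.2⟩
  rw [← Finset.sum_sdiff hsub, add_comm, mul_div_assoc]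
  gcongr
  calc ∑ p ∈ Nat.primesLE ⌊y⌋₊ \ Nat.primesLE ⌊x⌋₊, (1 - (f p * conj (g p)).re) / (p : ℝ)
      ≤ ∑ p ∈ Nat.primesLE ⌊y⌋₊ \ Nat.primesLE ⌊x⌋₊, 2 / ((⌊x⌋₊ : ℝ) + 1) := by
        refine Finset.sum_le_sum fun p hp ↦ ?_
        rw [Finset.mem_sdiff, Nat.mem_primesLE, Nat.mem_primesLE] at hp
        have hp1 : ⌊x⌋₊ + 1 ≤ p :=
          Nat.succ_le_of_lt (lt_of_not_ge fun hle ↦ hp.2 ⟨hle, hp.1.2⟩)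
        have hnum : 1 - (f p * conj (g p)).re ≤ 2 := by
          have : -(f p * conj (g p)).re ≤ 1 :=
            calc -(f p * conj (g p)).re ≤ |(f p * conj (g p)).re| := neg_le_abs _
              _ ≤ ‖f p * conj (g p)‖ := Complex.abs_re_le_norm _
              _ = ‖f p‖ * ‖g p‖ := by rw [norm_mul, Complex.norm_conj]
              _ ≤ 1 * 1 := mul_le_mul (hf p) (hg p) (norm_nonneg _) zero_le_one
              _ = 1 := one_mul 1
          linarith
        have hp0 : (0 : ℝ) < p := by exact_mod_cast hp.1.2.pos
        have hp1' : (⌊x⌋₊ : ℝ) + 1 ≤ p := by exact_mod_cast hp1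
        calc (1 - (f p * conj (g p)).re) / (p : ℝ) ≤ 2 / (p : ℝ) := by gcongr
          _ ≤ 2 / ((⌊x⌋₊ : ℝ) + 1) := by gcongr
    _ = ((Nat.primesLE ⌊y⌋₊ \ Nat.primesLE ⌊x⌋₊).card : ℝ) * (2 / ((⌊x⌋₊ : ℝ) + 1)) := by
        rw [Finset.sum_const, nsmul_eq_mul]
    _ ≤ ((⌊y⌋₊ : ℝ) + 1) * (2 / ((⌊x⌋₊ : ℝ) + 1)) := by
        gcongr
        have hcard : (Nat.primesLE ⌊y⌋₊ \ Nat.primesLE ⌊x⌋₊).card ≤ ⌊y⌋₊ + 1 :=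
          calc (Nat.primesLE ⌊y⌋₊ \ Nat.primesLE ⌊x⌋₊).card ≤ (Nat.primesLE ⌊y⌋₊).card :=
                Finset.card_le_card Finset.sdiff_subset
            _ ≤ (Finset.range (⌊y⌋₊ + 1)).card := by
                refine Finset.card_le_card fun p hp ↦ ?_
                rw [Nat.mem_primesLE] at hp
                exact Finset.mem_range.mpr (Nat.lt_succ_of_le hp.1)
            _ = ⌊y⌋₊ + 1 := Finset.card_range _
        exact_mod_cast hcard
    _ = 2 * (((⌊y⌋₊ : ℝ) + 1) / ((⌊x⌋₊ : ℝ) + 1)) := by ring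

/-- From per-character non-pretentiousness (`IsNonpretentious g`: for each fixed `χ`,
`inf_{|t| ≤ x} 𝔻(g, χ(n) n^{it}; x)² → ∞`, the hypothesis of Tao's Corollary 1.5 with `A = 1`)
to the hypothesis shape of Tao's Theorem 1.3: for every fixed `A ≥ 1` and all sufficiently large
`x`, `𝔻(g, χ(n) n^{it}; x)² ≥ A` for all moduli `1 ≤ q ≤ A`, all `χ (mod q)` and all
`|t| ≤ A x`. The height is lowered from `A x` to `x` by `pretentiousDistSq_le_add_of_le` (cost
`≤ 2A + 2`), and the finitely many characters of modulus `≤ A` are handled by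
`Filter.eventually_all`. In particular the hypothesis of Corollary 1.5 for `A = 1` implies it for
every `A ≥ 1`. (Tao 2016, §1, pp. 4–5; for `g = λ` compare `Literature.NumberTheory.LFunctions.Tao2016_liouvilleNonpretentious`.)
[cite: TaoFMP2016, §1, hypothesis of Corollary 1.5 versus hypothesis of Theorem 1.3] -/
theorem _root_.Literature.NumberTheory.Sieve.IsNonpretentious.eventually_le_pretentiousDistSq {g : ℕ → ℂ} (hg : ∀ n, ‖g n‖ ≤ 1)
    (h : Sieve.IsNonpretentious g) {A : ℝ} (hA : 1 ≤ A) :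
    ∀ᶠ x : ℝ in atTop, ∀ (q : ℕ) (χ : DirichletCharacter ℂ q) (t : ℝ), 1 ≤ q → (q : ℝ) ≤ A →
      |t| ≤ A * x → A ≤ Sieve.pretentiousDistSq g (Sieve.twistedChar χ t) x := by
  have hA0 : 0 < A := one_pos.trans_le hA
  have key : ∀ q ∈ Finset.Icc 1 ⌊A⌋₊, ∀ᶠ x : ℝ in atTop, ∀ (χ : DirichletCharacter ℂ q) (t : ℝ),
      |t| ≤ A * x → A ≤ Sieve.pretentiousDistSq g (Sieve.twistedChar χ t) x := by
    intro q hq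
    rw [Finset.mem_Icc] at hq
    haveI : NeZero q := ⟨by omega⟩
    have hχ : ∀ χ : DirichletCharacter ℂ q, ∀ᶠ x : ℝ in atTop, ∀ t : ℝ, |t| ≤ A * x →
        A ≤ Sieve.pretentiousDistSq g (Sieve.twistedChar χ t) x := by
      intro χ
      have h1 : Tendsto (fun x : ℝ ↦ Sieve.charNonpretentiousness g χ (A * x)) atTop atTop :=
        (h q χ).comp (tendsto_id.const_mul_atTop hA0)
      filter_upwards [h1.eventually_ge_atTop (3 * A + 2), eventually_ge_atTop (1 : ℝ)]
        with x hx hx1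
      intro t ht
      have hxAx : x ≤ A * x := le_mul_of_one_le_left (by linarith) hA
      have h2 : Sieve.charNonpretentiousness g χ (A * x) ≤
          Sieve.pretentiousDistSq g (Sieve.twistedChar χ t) (A * x) := by
        unfold Sieve.charNonpretentiousness
        have ht' : t ∈ Set.Icc (-(A * x)) (A * x) := ⟨(abs_le.mp ht).1, (abs_le.mp ht).2⟩
        refine ciInf_le ⟨0, ?_⟩ (⟨t, ht'⟩ : Set.Icc (-(A * x)) (A * x))
        rintro _ ⟨s, rfl⟩
        exact Sieve.pretentiousDistSq_nonneg hg (Sieve.norm_twistedChar_le_one χ s) _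
      have h3 := pretentiousDistSq_le_add_of_le hg (Sieve.norm_twistedChar_le_one χ t) hxAx
      have h4 : 2 * ((⌊A * x⌋₊ : ℝ) + 1) / ((⌊x⌋₊ : ℝ) + 1) ≤ 2 * A + 2 := by
        rw [div_le_iff₀ (by positivity)]
        have h5 : (⌊A * x⌋₊ : ℝ) ≤ A * x := Nat.floor_le (by positivity)
        have h6 : x < (⌊x⌋₊ : ℝ) + 1 := Nat.lt_floor_add_one x
        nlinarith [mul_lt_mul_of_pos_left h6 (by linarith : (0 : ℝ) < 2 * A + 2)]
      linarith
    exact Filter.eventually_all.mpr hχ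
  filter_upwards [(Filter.eventually_all_finset (Finset.Icc 1 ⌊A⌋₊)).mpr key]
    with x hx q χ t hq hqA ht
  exact hx q (Finset.mem_Icc.mpr ⟨hq, Nat.le_floor hqA⟩) χ t ht

/-! ### Theorem 1.3 ⇒ Corollary 1.5 -/

/-- **Tao 2016, Corollary 1.5** (logarithmically averaged Elliott conjecture), deduced from
Theorem 1.3 (`tao_log_averaged_elliott_two`) as in the paper ("Theorem 1.3 clearly implies the
following asymptotic version"). Let `a₁, a₂ ≥ 1`, `b₁, b₂` with `a₁ b₂ ≠ a₂ b₁`, let `g₁, g₂`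
be `1`-bounded multiplicative functions with `g₁` non-pretentious (for every fixed Dirichlet
character `χ`, `inf_{|t| ≤ x} 𝔻(g₁, χ(n) n^{it}; x)² → ∞`; by
`IsNonpretentious.eventually_le_pretentiousDistSq` this gives the printed hypothesis for every
`A ≥ 1`), and let `ω(x) ≤ x` (for large `x`) with `ω(x) → ∞`. Then
`∑_{x/ω(x) < n ≤ x} g₁(a₁ n + b₁) g₂(a₂ n + b₂) / n = o(log ω(x))`. [cite: TaoFMP2016, Corollary 1.5] -/
theorem log_averaged_elliott_of_nonasymptotic (H1 : tao_log_averaged_elliott_two)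
    {g₁ g₂ : ArithmeticFunction ℂ} (hg₁ : g₁.IsMultiplicative) (hg₂ : g₂.IsMultiplicative)
    (h₁ : ∀ n, ‖g₁ n‖ ≤ 1) (h₂ : ∀ n, ‖g₂ n‖ ≤ 1) (hnp : Sieve.IsNonpretentious ⇑g₁)
    {a₁ a₂ b₁ b₂ : ℕ} (ha₁ : 1 ≤ a₁) (ha₂ : 1 ≤ a₂) (hab : a₁ * b₂ ≠ a₂ * b₁)
    {ω : ℝ → ℝ} (hωx : ∀ᶠ x in atTop, ω x ≤ x) (hω : Tendsto ω atTop atTop) :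
    (fun x : ℝ ↦ ∑ n ∈ Ioc ⌊x / ω x⌋₊ ⌊x⌋₊, g₁ (a₁ * n + b₁) * g₂ (a₂ * n + b₂) / (n : ℂ))
      =o[atTop] fun x : ℝ ↦ Real.log (ω x) := by
  refine Asymptotics.isLittleO_iff.mpr fun c hc ↦ ?_
  obtain ⟨A₀, hA₀⟩ := H1 a₁ a₂ b₁ b₂ ha₁ ha₂ hab c hc
  set A : ℝ := max A₀ 1 with hA_def
  have hA1 : 1 ≤ A := le_max_right _ _
  filter_upwards [hnp.eventually_le_pretentiousDistSq h₁ hA1, hωx, hω.eventually_ge_atTop A]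
    with x hx hωx' hωA
  calc ‖∑ n ∈ Ioc ⌊x / ω x⌋₊ ⌊x⌋₊, g₁ (a₁ * n + b₁) * g₂ (a₂ * n + b₂) / (n : ℂ)‖
      ≤ c * Real.log (ω x) :=
        hA₀ A (le_max_left _ _) x (ω x) hωA hωx' g₁ g₂ hg₁ hg₂ h₁ h₂
          (fun q χ t hq hqA ht ↦ hx q χ t hq hqA ht)
    _ ≤ c * ‖Real.log (ω x)‖ := by gcongr; exact Real.le_norm_self _

/-- **Tao 2016, Corollary 1.5 with `ω(x) = x`**, along `x : ℕ` and with the sum extended to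
`n = 1`: under the hypotheses of `log_averaged_elliott_of_nonasymptotic`,
`∑_{n ≤ x} g₁(a₁ n + b₁) g₂(a₂ n + b₂) / n = o(log x)`. (The paper's sum for `ω(x) = x` runs
over `1 < n ≤ x`; the term `n = 1` has modulus `≤ 1 = o(log x)`.)
[cite: TaoFMP2016, Corollary 1.5 and §1 p. 5] -/
theorem log_averaged_elliott_nat_of_nonasymptotic (H1 : tao_log_averaged_elliott_two)
    {g₁ g₂ : ArithmeticFunction ℂ} (hg₁ : g₁.IsMultiplicative) (hg₂ : g₂.IsMultiplicative)
    (h₁ : ∀ n, ‖g₁ n‖ ≤ 1) (h₂ : ∀ n, ‖g₂ n‖ ≤ 1) (hnp : Sieve.IsNonpretentious ⇑g₁)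
    {a₁ a₂ b₁ b₂ : ℕ} (ha₁ : 1 ≤ a₁) (ha₂ : 1 ≤ a₂) (hab : a₁ * b₂ ≠ a₂ * b₁) :
    (fun x : ℕ ↦ ∑ n ∈ Icc 1 x, g₁ (a₁ * n + b₁) * g₂ (a₂ * n + b₂) / (n : ℂ))
      =o[atTop] fun x : ℕ ↦ Real.log x := by
  refine Asymptotics.isLittleO_iff.mpr fun c hc ↦ ?_
  obtain ⟨A₀, hA₀⟩ := H1 a₁ a₂ b₁ b₂ ha₁ ha₂ hab (c / 2) (half_pos hc)
  set A : ℝ := max A₀ 1 with hA_def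
  have hA1 : 1 ≤ A := le_max_right _ _
  have hlog : ∀ᶠ x : ℕ in atTop, 2 / c ≤ Real.log x :=
    (Real.tendsto_log_atTop.comp tendsto_natCast_atTop_atTop).eventually_ge_atTop _
  filter_upwards [tendsto_natCast_atTop_atTop.eventually
    (hnp.eventually_le_pretentiousDistSq h₁ hA1), hlog, eventually_ge_atTop ⌈A⌉₊,
    eventually_ge_atTop 1] with x hx hlogx hxA hx1
  have hxA' : A ≤ (x : ℝ) := (Nat.le_ceil A).trans (by exact_mod_cast hxA)
  have key := hA₀ A (le_max_left _ _) x x hxA' le_rfl g₁ g₂ hg₁ hg₂ h₁ h₂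
    (fun q χ t hq hqA ht ↦ hx q χ t hq hqA ht)
  have hx0 : (x : ℝ) ≠ 0 := by positivity
  rw [div_self hx0, Nat.floor_one, Nat.floor_natCast] at key
  -- `key : ‖∑ n ∈ Ioc 1 x, g₁ (a₁ n + b₁) * g₂ (a₂ n + b₂) / n‖ ≤ c / 2 * log x`
  have hfirst : ‖g₁ (a₁ * 1 + b₁) * g₂ (a₂ * 1 + b₂) / ((1 : ℕ) : ℂ)‖ ≤ 1 := by
    rw [Nat.cast_one, div_one, norm_mul]
    exact mul_le_one₀ (h₁ _) (norm_nonneg _) (h₂ _)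
  rw [← Finset.add_sum_Ioc_eq_sum_Icc hx1]
  have hlog0 : 0 ≤ Real.log x := Real.log_natCast_nonneg x
  have hc2 : 1 ≤ c / 2 * Real.log x := by
    rw [div_le_iff₀ hc] at hlogx
    linarith
  calc _ ≤ ‖g₁ (a₁ * 1 + b₁) * g₂ (a₂ * 1 + b₂) / ((1 : ℕ) : ℂ)‖ +
        ‖∑ n ∈ Ioc 1 x, g₁ (a₁ * n + b₁) * g₂ (a₂ * n + b₂) / (n : ℂ)‖ := norm_add_le _ _
    _ ≤ 1 + c / 2 * Real.log x := add_le_add hfirst key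
    _ ≤ c * Real.log x := by linarith
    _ ≤ c * ‖Real.log (x : ℝ)‖ := by rw [Real.norm_of_nonneg hlog0]

/-! ### Theorem 1.3 ⇒ Theorem 1.2 (general cutoff) for `λ`, unconditionally in `λ` -/

/-- `Literature.NumberTheory.LFunctions.isNonpretentious_liouville_holds` (`LiouvilleNonpretentious`) transported to the
complexified arithmetic function `(λ : ArithmeticFunction ℂ)` used in
`tao_log_averaged_elliott_two`. [folklore] -/
theorem isNonpretentious_liouville_coe :
    Sieve.IsNonpretentious ⇑(ArithmeticFunction.liouville : ArithmeticFunction ℂ) := by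
  have hfun : ⇑(ArithmeticFunction.liouville : ArithmeticFunction ℂ) =
      fun n ↦ (ArithmeticFunction.liouville n : ℂ) := by
    funext n
    exact ArithmeticFunction.intCoe_apply
  rw [hfun]
  exact isNonpretentious_liouville_holds

/-- **Tao 2016, Theorem 1.2 as printed** (general cutoff `ω`), from Theorem 1.3
(`tao_log_averaged_elliott_two`) alone, the non-pretentiousness of `λ` being the theorem
`Literature.NumberTheory.LFunctions.isNonpretentious_liouville_holds`: for `a₁, a₂ ≥ 1`, natural `b₁, b₂` with
`a₁ b₂ ≠ a₂ b₁`, and any cutoff with `ω(x) ≤ x` (for large `x`) and `ω(x) → ∞`,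
`∑_{x/ω(x) < n ≤ x} λ(a₁ n + b₁) λ(a₂ n + b₂) / n = o(log ω(x))`. (The paper allows integer
shifts; natural shifts as in parity.S21. The case `ω(x) = x` is
`Literature.NumberTheory.LFunctions.tao_log_chowla_liouville_of_elliott_two`.)
[cite: TaoFMP2016, Theorem 1.2 (deduced from Theorem 1.3 via Corollary 1.5, §1 p. 5)] -/
theorem tao_log_chowla_omega_of_elliott_two (H1 : tao_log_averaged_elliott_two)
    {a₁ a₂ b₁ b₂ : ℕ} (ha₁ : 1 ≤ a₁) (ha₂ : 1 ≤ a₂) (hab : a₁ * b₂ ≠ a₂ * b₁) {ω : ℝ → ℝ}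
    (hωx : ∀ᶠ x in atTop, ω x ≤ x) (hω : Tendsto ω atTop atTop) :
    (fun x : ℝ ↦ ∑ n ∈ Ioc ⌊x / ω x⌋₊ ⌊x⌋₊,
        (ArithmeticFunction.liouville (a₁ * n + b₁) *
          ArithmeticFunction.liouville (a₂ * n + b₂) : ℝ) / n)
      =o[atTop] fun x : ℝ ↦ Real.log (ω x) := by
  have key := log_averaged_elliott_of_nonasymptotic H1 isMultiplicative_liouville_complex
    isMultiplicative_liouville_complex norm_liouville_complex_le_one
    norm_liouville_complex_le_one isNonpretentious_liouville_coe ha₁ ha₂ hab hωx hω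
  refine Asymptotics.IsLittleO.of_norm_left (key.norm_left.congr_left fun x ↦ ?_)
  rw [← Complex.norm_real]
  congr 1
  push_cast
  simp only [ArithmeticFunction.intCoe_apply]

/-! ### The two-point case `tao_log_chowla_two` -/

/-- The two-point case: `Parity.tao_log_chowla_liouville` (parity.S21, Tao 2016 Theorem 1.2 with
`ω(x) = x`) specialised to `a₁ = a₂ = 1`, `b₁ = 0`, `b₂ = h` gives `tao_log_chowla_two`
(the display following Theorem 1.2 on p. 3 of the paper is the case `h = 1`).
[cite: TaoFMP2016, Theorem 1.2 and the display following it (case ω(x) = x)] -/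
theorem tao_log_chowla_two_of_liouville (H : Sieve.tao_log_chowla_liouville) :
    tao_log_chowla_two := by
  intro h hh
  simpa using H 1 1 0 h le_rfl le_rfl (by simpa using hh)

/-- **Tao 2016, Theorem 1.3 ⇒ two-point log-Chowla.** The logarithmically averaged two-point
Chowla estimate `∑_{n ≤ x} λ(n) λ(n + h) / n = o(log x)` (`tao_log_chowla_two`) follows from
Tao's non-asymptotic Elliott estimate `tao_log_averaged_elliott_two` (Theorem 1.3) alone, the
non-pretentiousness of `λ` being proved in `LiouvilleNonpretentious`.
[cite: TaoFMP2016, §1, p. 5: Theorem 1.3 ⇒ Corollary 1.5 ⇒ Theorem 1.2 (case ω(x) = x)] -/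
theorem tao_log_chowla_two_of_elliott_two (H1 : tao_log_averaged_elliott_two) :
    tao_log_chowla_two :=
  tao_log_chowla_two_of_liouville (LFunctions.tao_log_chowla_liouville_of_elliott_two H1)

/-- **Tao 2016, Theorem 2.3 ⇒ two-point log-Chowla.** `tao_log_chowla_two` follows from the
single named fact `Literature.NumberTheory.LFunctions.Tao2016_theorem23` (Tao 2016, Theorem 2.3, the statement proved by the
entropy decrement argument in §§3–4), via `Literature.NumberTheory.LFunctions.tao_log_chowla_liouville_of_theorem23`.
[cite: TaoFMP2016, §2 (first paragraph: Theorem 1.2 for λ follows directly from Theorem 2.3)] -/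
theorem tao_log_chowla_two_of_theorem23 (h23 : Tao2016_theorem23) : tao_log_chowla_two :=
  tao_log_chowla_two_of_liouville (LFunctions.tao_log_chowla_liouville_of_theorem23 h23)

end Reductions

end Literature.NumberTheory.LFunctions

/-! ## The corrected Elliott conjecture implies Chowla's conjecture (MRT 2015, §1)

Matomäki–Radziwiłł–Tao, arXiv:1503.05121, p. 4, immediately after Conjecture 1.5: "From the prime
number theorem in arithmetic progressions it follows that `M(λ; ∞, ∞) = ∞`, so Elliott's conjecture
implies Chowla's conjecture"; for the corrected hypothesis (1.8) the required input is the
per-character divergence `inf_{|t| ≤ x} 𝔻(λ, χ(n)n^{it}; x)² → ∞`, which is the tree THEOREM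
`isNonpretentious_liouville_holds` (and `isNonpretentious_moebius_holds` for `μ`, which agrees
with `λ` at primes). Klurman–Mangerel–Teräväinen (arXiv:2304.05344, §1): "Elliott's conjecture
includes as a special case Chowla's conjecture, which is the case where `f₁ = ⋯ = f_k = μ`". The
statement `ElliottConjectureMRT` itself is an OPEN conjecture ("can be corrected to a form believed
to be true", loc. cit.), so no `ElliottConjectureMRT_holds` can be offered; the two theorems below
make its strength explicit inside the tree: it implies parity.S06 in both forms, which are open for
every `k ≥ 2`. -/

namespace Literature.NumberTheory.LFunctions

section ElliottImpliesChowla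

open scoped ArithmeticFunction.Moebius

/-- Index bookkeeping between parity.S24 and parity.S06: if `‖f n‖ ≤ 1` and
`∑_{1 ≤ n ≤ x} f(n) = o(x)` then `∑_{n < x} f(n) = o(x)` (the two sums differ by `f(0) - f(x)`,
of modulus `≤ 2 = o(x)`). [folklore] -/
theorem isLittleO_sum_range_of_sum_Icc {f : ℕ → ℂ} (hf : ∀ n, ‖f n‖ ≤ 1)
    (h : (fun x : ℕ ↦ ∑ n ∈ Icc 1 x, f n) =o[atTop] fun x : ℕ ↦ (x : ℂ)) :
    (fun x : ℕ ↦ ∑ n ∈ range x, f n) =o[atTop] fun x : ℕ ↦ (x : ℂ) := by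
  have hId : ∀ x : ℕ, ∑ n ∈ Icc 1 x, f n + (f 0 - f x) = ∑ n ∈ range x, f n := by
    intro x
    have h1 : ∑ n ∈ range (x + 1), f n = ∑ n ∈ range x, f n + f x := Finset.sum_range_succ f x
    have h2 : ∑ n ∈ range (x + 1), f n = (∑ n ∈ range x, f (n + 1)) + f 0 :=
      Finset.sum_range_succ' f x
    have h3 : ∀ y : ℕ, ∑ n ∈ Icc 1 y, f n = ∑ n ∈ range y, f (n + 1) := by
      intro y
      induction y with
      | zero => simp
      | succ y ih => rw [Finset.sum_Icc_succ_top (by omega), ih, Finset.sum_range_succ]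
    rw [h3 x]
    linear_combination h1 - h2
  have h2 : (fun x : ℕ ↦ f 0 - f x) =o[atTop] fun x : ℕ ↦ (x : ℂ) := by
    refine Asymptotics.isLittleO_iff.mpr fun c hc ↦ ?_
    filter_upwards [eventually_ge_atTop ⌈2 / c⌉₊] with x hx
    have hx' : 2 / c ≤ (x : ℝ) := (Nat.le_ceil _).trans (by exact_mod_cast hx)
    rw [Complex.norm_natCast]
    calc ‖f 0 - f x‖ ≤ ‖f 0‖ + ‖f x‖ := norm_sub_le _ _
      _ ≤ 2 := by linarith [hf 0, hf x]
      _ ≤ c * x := by rwa [div_le_iff₀' hc] at hx'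
  exact (h.add h2).congr_left hId

/-- Normalisation bookkeeping: an integer-valued sequence which is `o(x)` after casting to `ℂ`
is `o(x)` after casting to `ℝ` (parity.S24 is stated over `ℂ`, parity.S06 over `ℝ`). [folklore] -/
theorem isLittleO_intCast_real_of_complex {T : ℕ → ℤ}
    (h : (fun x : ℕ ↦ ((T x : ℤ) : ℂ)) =o[atTop] fun x : ℕ ↦ (x : ℂ)) :
    (fun x : ℕ ↦ ((T x : ℤ) : ℝ)) =o[atTop] fun x : ℕ ↦ (x : ℝ) := by
  refine Asymptotics.IsLittleO.of_norm_right (Asymptotics.IsLittleO.of_norm_left ?_)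
  refine h.norm_norm.congr (fun x ↦ ?_) (fun x ↦ ?_)
  · rw [Complex.norm_intCast, Real.norm_eq_abs]
  · rw [Complex.norm_natCast, Real.norm_natCast]

/-- **The corrected Elliott conjecture implies Chowla's conjecture** (Liouville form,
`Literature.NumberTheory.Sieve.ChowlaConjecture`, parity.S06): take `g₁ = ⋯ = g_k = λ` in
`ElliottConjectureMRT`; `λ` is completely multiplicative, `1`-bounded, and non-pretentious in the
corrected sense (1.8) by the THEOREM `isNonpretentious_liouville_holds`, so the implication is
unconditional. (Matomäki–Radziwiłł–Tao 2015, §1, the sentence following Conjecture 1.5: "so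
Elliott's conjecture implies Chowla's conjecture".)
[cite: MatomakiRadziwillTao2015, §1, remark after Conjecture 1.5 (arXiv p. 4)] -/
theorem chowlaConjecture_of_elliottConjectureMRT (hE : ElliottConjectureMRT) :
    Sieve.ChowlaConjecture := by
  intro k h hk hinj
  have key := hE k (fun _ ↦ (ArithmeticFunction.liouville : ArithmeticFunction ℂ)) h
    (fun _ ↦ isMultiplicative_liouville_complex) (fun _ ↦ norm_liouville_complex_le_one) hinj
    ⟨⟨0, hk⟩, isNonpretentious_liouville_coe⟩
  have hf : ∀ n, ‖∏ i, (ArithmeticFunction.liouville : ArithmeticFunction ℂ) (n + h i)‖ ≤ 1 :=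
    fun n ↦ (Finset.norm_prod_le _ _).trans
      (Finset.prod_le_one (fun i _ ↦ norm_nonneg _) fun i _ ↦ norm_liouville_complex_le_one _)
  have hcast : ∀ x : ℕ, ((Sieve.liouvilleCorrelation h x : ℤ) : ℂ) =
      ∑ n ∈ range x, ∏ i, (ArithmeticFunction.liouville : ArithmeticFunction ℂ) (n + h i) := by
    intro x
    simp only [Sieve.liouvilleCorrelation, Int.cast_sum, Int.cast_prod,
      ArithmeticFunction.intCoe_apply]
  refine isLittleO_intCast_real_of_complex ?_
  simp_rw [hcast]
  exact isLittleO_sum_range_of_sum_Icc hf key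

/-- `Literature.NumberTheory.LFunctions.isNonpretentious_moebius_holds` (`LiouvilleNonpretentious`) transported to the
complexified arithmetic function `(μ : ArithmeticFunction ℂ)`. [folklore] -/
theorem isNonpretentious_moebius_coe :
    Sieve.IsNonpretentious ⇑(ArithmeticFunction.moebius : ArithmeticFunction ℂ) := by
  have hfun : ⇑(ArithmeticFunction.moebius : ArithmeticFunction ℂ) =
      fun n ↦ (ArithmeticFunction.moebius n : ℂ) := by
    funext n
    exact ArithmeticFunction.intCoe_apply
  rw [hfun]
  exact isNonpretentious_moebius_holds

/-- **The corrected Elliott conjecture implies Chowla's conjecture in Möbius form with sign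
patterns** (`Literature.NumberTheory.Sieve.MoebiusChowlaConjecture`, parity.S06; Chowla 1965, Sarnak 2010): take
`g_i = μ^{a_i}` (pointwise power, `a_i ∈ {1, 2}`) in `ElliottConjectureMRT`; each `g_i` is
multiplicative and `1`-bounded, and an index with `a_i = 1` carries `g_i = μ`, non-pretentious in
the corrected sense (1.8) by the THEOREM `isNonpretentious_moebius_holds` (`μ = λ` at primes).
(Klurman–Mangerel–Teräväinen 2023, §1: "Elliott's conjecture includes as a special case Chowla's
conjecture, which is the case where `f₁ = ⋯ = f_k = μ`"; Matomäki–Radziwiłł–Tao 2015, §1.)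
[cite: MatomakiRadziwillTao2015, §1, remark after Conjecture 1.5 (arXiv p. 4)] -/
theorem moebiusChowlaConjecture_of_elliottConjectureMRT (hE : ElliottConjectureMRT) :
    Sieve.MoebiusChowlaConjecture := by
  intro k h a hinj ha h1
  obtain ⟨i₀, hi₀⟩ := h1
  have hapos : ∀ i, 0 < a i := fun i ↦ by rcases ha i with h' | h' <;> omega
  set M : ArithmeticFunction ℂ := (ArithmeticFunction.moebius : ArithmeticFunction ℂ) with hM
  have hMb : ∀ n, ‖M n‖ ≤ 1 := norm_moebius_complex_le_one
  have hg1 : ∀ i n, ‖(M.ppow (a i)) n‖ ≤ 1 := fun i n ↦ by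
    rw [ArithmeticFunction.ppow_apply (hapos i), norm_pow]
    exact pow_le_one₀ (norm_nonneg _) (hMb n)
  have hM1 : M.ppow (a i₀) = M := by
    ext n
    rw [ArithmeticFunction.ppow_apply (hapos i₀), hi₀, pow_one]
  have hnp : Sieve.IsNonpretentious ⇑(M.ppow (a i₀)) := by
    rw [hM1]
    exact isNonpretentious_moebius_coe
  have key := hE k (fun i ↦ M.ppow (a i)) h
    (fun i ↦ isMultiplicative_moebius_complex.ppow) hg1 hinj ⟨i₀, hnp⟩
  have hf : ∀ n, ‖∏ i, (M.ppow (a i)) (n + h i)‖ ≤ 1 :=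
    fun n ↦ (Finset.norm_prod_le _ _).trans
      (Finset.prod_le_one (fun i _ ↦ norm_nonneg _) fun i _ ↦ hg1 i _)
  have hcast : ∀ x : ℕ, ((Sieve.moebiusCorrelation h a x : ℤ) : ℂ) =
      ∑ n ∈ range x, ∏ i, (M.ppow (a i)) (n + h i) := by
    intro x
    simp only [Sieve.moebiusCorrelation, Int.cast_sum, Int.cast_prod, Int.cast_pow]
    refine Finset.sum_congr rfl fun n _ ↦ Finset.prod_congr rfl fun i _ ↦ ?_
    rw [ArithmeticFunction.ppow_apply (hapos i), hM, ArithmeticFunction.intCoe_apply]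
  refine isLittleO_intCast_real_of_complex ?_
  simp_rw [hcast]
  exact isLittleO_sum_range_of_sum_Icc hf key

end ElliottImpliesChowla

end Literature.NumberTheory.LFunctions
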